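import Summits.CriticalPhenomena.Ising3DConformalLimit.Theorems.HarmonicMomentsIsotropyDilutionTransferLaplacian
import HarnessLib

/-!
# Route HarmonicMomentsIsotropy — the Gaussian rung of `HarmonicDilution`, Ia: degree filtration

Support file for item `stmt-CriticalPhenomena-6034` (`HarmonicDilution`).  The item (subcritical
harmonic dilution of the Ising two-point function on `ℤ³`) is the Campostrini–Pelissetto–Rossi–Vicari
prediction; its SOLVABLE RUNG — the same statement for the massive lattice Gaussian field, i.e. for
the simple-random-walk Green function `C_t = ∑ₙ tⁿ D^{⋆n}` — is a theorem ("`ρ = 2` exactly",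
CampostriniEtAl1998 §4.2), and the route's thesis asserts that the angular hierarchy is a theorem
on every such convolution rung (thesis, "A THEOREM … for every convolution hierarchy").  The rung is
proved in the files `…GaussianRung{Filtration,Symbol,Moments}` and `…GaussianRung`; this first one
sets up the algebra on `ℝ[X₀,X₁,X₂]`:

* `degFilt d` — the degree filtration (the submodule of polynomials all of whose monomials have
  degree `≤ d`, `d : ℤ`, so that a negative bound forces `P = 0`, `eq_zero_of_mem_degFilt`), with
  its closure under products, powers, degree-lowering linear maps, `∂ᵢ` and `Δ`;
* `shiftAlg i c` — the lattice translate `P ↦ P(X + c eᵢ)` (`eval_shiftAlg`), `sdiff i` — the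
  second difference, and `dlap` — the discrete Laplacian `N = ∑ᵢ (τᵢ + τᵢ⁻¹ - 2)` with
  `eval_dlap` (its values are the graph Laplacian of `ℤ³` applied to `v ↦ P(v)`).

Elementary and self-contained; continues `…DilutionTransferLaplacian` (`lap`, `rsq`).
-/

noncomputable section

open MvPolynomial Finset

namespace Summit.CriticalPhenomena.Ising3DConformalLimit.Theorems.HarmonicMomentsIsotropy.GaussianRung

open Summit.CriticalPhenomena.Ising3DConformalLimit.Theorems.HarmonicMomentsIsotropy.Fischer
  (Poly lap lap_apply pd pd_apply)

/-! ## The degree filtration -/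

/-- The degree of an exponent vector, as an integer. -/
def ideg (s : Fin 3 →₀ ℕ) : ℤ := ((Finsupp.degree s : ℕ) : ℤ)

/-- `ideg` is additive. -/
theorem ideg_add (s t : Fin 3 →₀ ℕ) : ideg (s + t) = ideg s + ideg t := by
  simp only [ideg, map_add, Nat.cast_add]

/-- `ideg` is nonnegative. -/
theorem ideg_nonneg (s : Fin 3 →₀ ℕ) : 0 ≤ ideg s := Int.natCast_nonneg _

/-- `ideg (single i k) = k`. -/
theorem ideg_single (i : Fin 3) (k : ℕ) : ideg (Finsupp.single i k) = k := by
  simp only [ideg, Finsupp.degree_single]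

/-- **The degree filtration** `V_d` of `ℝ[X₀,X₁,X₂]`: polynomials all of whose monomials have total
degree `≤ d` (`d` an integer; `V_d = 0` for `d < 0`). -/
def degFilt (d : ℤ) : Submodule ℝ Poly where
  carrier := {P | ∀ s : Fin 3 →₀ ℕ, coeff s P ≠ 0 → ideg s ≤ d}
  add_mem' := by
    intro P Q hP hQ s hs
    rw [coeff_add] at hs
    by_cases h : coeff s P = 0
    · rw [h, zero_add] at hs
      exact hQ s hs
    · exact hP s h
  zero_mem' := fun s hs => (hs (coeff_zero s)).elim
  smul_mem' := by
    intro c P hP s hs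
    rw [coeff_smul, smul_eq_mul] at hs
    exact hP s (right_ne_zero_of_mul hs)

/-- Membership in the filtration, unfolded. -/
theorem mem_degFilt {P : Poly} {d : ℤ} :
    P ∈ degFilt d ↔ ∀ s : Fin 3 →₀ ℕ, coeff s P ≠ 0 → ideg s ≤ d := Iff.rfl

/-- Monotonicity of the filtration. -/
theorem degFilt_mono {d d' : ℤ} (hd : d ≤ d') : degFilt d ≤ degFilt d' :=
  fun _ h s hs => (h s hs).trans hd

/-- A negative filtration step is zero. -/
theorem eq_zero_of_mem_degFilt {P : Poly} {d : ℤ} (hP : P ∈ degFilt d) (hd : d < 0) : P = 0 := by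
  ext s
  rw [coeff_zero]
  by_contra h
  have h1 := hP s h
  have h2 := ideg_nonneg s
  omega

/-- A monomial of exponent `s` lies in step `deg s`. -/
theorem monomial_mem_degFilt (s : Fin 3 →₀ ℕ) (a : ℝ) : (monomial s a : Poly) ∈ degFilt (ideg s) := by
  intro t ht
  rw [coeff_monomial] at ht
  by_cases h : s = t
  · rw [h]
  · rw [if_neg h] at ht; exact (ht rfl).elim

/-- `Xᵢ` has degree `≤ 1`. -/
theorem X_mem_degFilt (i : Fin 3) : (X i : Poly) ∈ degFilt 1 := by
  have h := monomial_mem_degFilt (Finsupp.single i 1) 1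
  rwa [ideg_single, ← X_pow_eq_monomial, pow_one, Nat.cast_one] at h

/-- Constants have degree `≤ 0`. -/
theorem C_mem_degFilt (c : ℝ) : (C c : Poly) ∈ degFilt 0 := by
  have h := monomial_mem_degFilt 0 c
  rwa [ideg, map_zero, Nat.cast_zero] at h

/-- `1` has degree `≤ 0`. -/
theorem one_mem_degFilt : (1 : Poly) ∈ degFilt 0 := by
  have h := C_mem_degFilt 1
  rwa [C_1] at h

/-- A homogeneous polynomial of degree `n` lies in step `n`. -/
theorem mem_degFilt_of_isHomogeneous {P : Poly} {n : ℕ} (hP : P.IsHomogeneous n) :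
    P ∈ degFilt n := by
  intro s hs
  by_contra h
  exact hs (hP.coeff_eq_zero fun h' => h (by rw [ideg, h']))

/-- The filtration is multiplicative. -/
theorem mul_mem_degFilt {P Q : Poly} {a b : ℤ} (hP : P ∈ degFilt a) (hQ : Q ∈ degFilt b) :
    P * Q ∈ degFilt (a + b) := by
  classical
  intro s hs
  rw [coeff_mul] at hs
  obtain ⟨x, hx, hne⟩ := Finset.exists_ne_zero_of_sum_ne_zero hs
  have hx' : x.1 + x.2 = s := by simpa using hx
  have ha := hP _ (left_ne_zero_of_mul hne)
  have hb := hQ _ (right_ne_zero_of_mul hne)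
  rw [← hx', ideg_add]
  linarith

/-- The filtration is closed under powers. -/
theorem pow_mem_degFilt {P : Poly} {a : ℤ} (hP : P ∈ degFilt a) :
    ∀ n : ℕ, P ^ n ∈ degFilt (n * a)
  | 0 => by
    rw [pow_zero, Nat.cast_zero, zero_mul]
    exact one_mem_degFilt
  | n + 1 => by
    rw [pow_succ]
    have h := mul_mem_degFilt (pow_mem_degFilt hP n) hP
    have e : (n : ℤ) * a + a = ((n + 1 : ℕ) : ℤ) * a := by push_cast; ring
    rwa [e] at h

/-- Finite sums stay in a filtration step. -/
theorem sum_mem_degFilt {ι : Type*} (s : Finset ι) {f : ι → Poly} {d : ℤ}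
    (h : ∀ i ∈ s, f i ∈ degFilt d) : (∑ i ∈ s, f i) ∈ degFilt d :=
  Submodule.sum_mem _ h

/-- A linear map that lowers the degree of every monomial by `k` lowers the filtration by `k`. -/
theorem linear_mem_degFilt (L : Poly →ₗ[ℝ] Poly) (k : ℤ)
    (hL : ∀ s : Fin 3 →₀ ℕ, L (monomial s 1) ∈ degFilt (ideg s - k))
    {P : Poly} {d : ℤ} (hP : P ∈ degFilt d) : L P ∈ degFilt (d - k) := by
  rw [P.as_sum, map_sum]
  refine sum_mem_degFilt _ fun s hs => ?_
  have e : monomial s (coeff s P) = coeff s P • monomial s (1 : ℝ) := by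
    rw [smul_monomial, smul_eq_mul, mul_one]
  rw [e, map_smul]
  refine Submodule.smul_mem _ _ (degFilt_mono ?_ (hL s))
  have := hP s (mem_support_iff.mp hs)
  omega

/-- A partial derivative lowers the filtration by one. -/
theorem pderiv_mem_degFilt {P : Poly} {d : ℤ} (hP : P ∈ degFilt d) (i : Fin 3) :
    pderiv i P ∈ degFilt (d - 1) := by
  have h := linear_mem_degFilt (pd i) 1 (fun s => ?_) hP
  · simpa only [pd_apply] using h
  · rw [pd_apply, pderiv_monomial, one_mul]
    by_cases hsi : s i = 0
    · rw [hsi, Nat.cast_zero, monomial_zero]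
      exact Submodule.zero_mem _
    · refine degFilt_mono (le_of_eq ?_) (monomial_mem_degFilt _ _)
      have hle : Finsupp.single i 1 ≤ s :=
        Finsupp.single_le_iff.mpr (Nat.one_le_iff_ne_zero.mpr hsi)
      have e : s - Finsupp.single i 1 + Finsupp.single i 1 = s := tsub_add_cancel_of_le hle
      have := congrArg ideg e
      rw [ideg_add, ideg_single] at this
      omega

/-- The Laplacian lowers the filtration by two. -/
theorem lap_mem_degFilt {P : Poly} {d : ℤ} (hP : P ∈ degFilt d) : lap P ∈ degFilt (d - 2) := by
  rw [lap_apply]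
  refine sum_mem_degFilt _ fun i _ => ?_
  have h := pderiv_mem_degFilt (pderiv_mem_degFilt hP i) i
  have e : d - 1 - 1 = d - 2 := by ring
  rwa [e] at h

/-- Iterated Laplacians lower the filtration by two each. -/
theorem lap_iterate_mem_degFilt {P : Poly} {d : ℤ} (hP : P ∈ degFilt d) :
    ∀ k : ℕ, lap^[k] P ∈ degFilt (d - 2 * k)
  | 0 => by simpa using hP
  | k + 1 => by
    rw [Function.iterate_succ_apply']
    have h := lap_mem_degFilt (lap_iterate_mem_degFilt hP k)
    have e : d - 2 * (k : ℤ) - 2 = d - 2 * ((k + 1 : ℕ) : ℤ) := by push_cast; ring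
    rwa [e] at h

/-! ## Lattice translates and the discrete Laplacian on `ℝ[X₀,X₁,X₂]` -/

/-- The lattice translate `P ↦ P(X + c eᵢ)` as an `ℝ`-algebra endomorphism of `ℝ[X₀,X₁,X₂]`. -/
def shiftAlg (i : Fin 3) (c : ℝ) : Poly →ₐ[ℝ] Poly :=
  bind₁ fun j => X j + C (if j = i then c else 0)

/-- `τ_{i,c} Xⱼ = Xⱼ + c δᵢⱼ`. -/
theorem shiftAlg_X (i : Fin 3) (c : ℝ) (j : Fin 3) :
    shiftAlg i c (X j) = X j + C (if j = i then c else 0) :=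
  bind₁_X_right _ _

/-- Evaluation of a translate: `(τ_{i,c} P)(v) = P(v + c eᵢ)`. -/
theorem eval_shiftAlg (i : Fin 3) (c : ℝ) (v : Fin 3 → ℝ) (P : Poly) :
    eval v (shiftAlg i c P) = eval (v + Pi.single i c) P := by
  have h : (fun j => eval v (X j + C (if j = i then c else 0))) = v + Pi.single i c := by
    funext j
    rw [map_add, eval_X, eval_C, Pi.add_apply, Pi.single_apply]
  rw [← h]
  exact eval₂Hom_bind₁ (RingHom.id ℝ) v _ P

/-- The second difference in direction `i`: `P(X + eᵢ) + P(X - eᵢ) - 2 P`, a linear map. -/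
def sdiff (i : Fin 3) : Poly →ₗ[ℝ] Poly :=
  (shiftAlg i 1).toLinearMap + (shiftAlg i (-1)).toLinearMap - (2 : ℝ) • LinearMap.id

/-- Unfolding `sdiff`. -/
theorem sdiff_apply (i : Fin 3) (P : Poly) :
    sdiff i P = shiftAlg i 1 P + shiftAlg i (-1) P - (2 : ℝ) • P := rfl

/-- **The discrete Laplacian** `N P = ∑ᵢ (P(X + eᵢ) + P(X - eᵢ) - 2P)` on `ℝ[X₀,X₁,X₂]`. -/
def dlap : Poly →ₗ[ℝ] Poly := ∑ i : Fin 3, sdiff i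

/-- Unfolding `dlap`. -/
theorem dlap_apply (P : Poly) :
    dlap P = ∑ i : Fin 3, (shiftAlg i 1 P + shiftAlg i (-1) P - (2 : ℝ) • P) := by
  simp only [dlap, LinearMap.coe_sum, Finset.sum_apply, sdiff_apply]

/-- Evaluation of the discrete Laplacian: the graph Laplacian of `ℤ³` applied to `v ↦ P(v)`. -/
theorem eval_dlap (v : Fin 3 → ℝ) (P : Poly) :
    eval v (dlap P) =
      ∑ i : Fin 3, (eval (v + Pi.single i 1) P + eval (v - Pi.single i 1) P) - 2 * 3 * eval v P := by
  rw [dlap_apply, map_sum]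
  have key : ∀ i : Fin 3, eval v (shiftAlg i 1 P + shiftAlg i (-1) P - (2 : ℝ) • P) =
      (eval (v + Pi.single i 1) P + eval (v - Pi.single i 1) P) - 2 * eval v P := by
    intro i
    rw [map_sub, map_add, eval_shiftAlg, eval_shiftAlg, smul_eval, sub_eq_add_neg v,
      ← Pi.single_neg]
  simp only [key, Finset.sum_sub_distrib, Finset.sum_const, Finset.card_univ, Fintype.card_fin,
    nsmul_eq_mul]
  ring

end Summit.CriticalPhenomena.Ising3DConformalLimit.Theorems.HarmonicMomentsIsotropy.GaussianRung
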